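import Literature.MathematicalPhysics.QuantumLattice.HubbardTTPrimeThermalPressureBoxWords
import Literature.MathematicalPhysics.QuantumLattice.HubbardTTPrimeThermalPressureDensityBand
import HarnessLib

/-!
# `T > 0` box words from ONE anchor: the joint `(β, t', U)` tangent floor × the sharp density band ⇒ a
# thermal-energy cap on a whole `(T ≤ 1/β₀) × [s₁,s₂] × [U₁,U₂] × [n₁,n₂]` box from a single certified point

Family `hubbard` (topic `MathematicalPhysics/QuantumLattice`); stage S2 of the Hubbard material oracle (`T > 0`
certifier family, D-0096 (iii); `T` axis of the phase maps, D-0099). Third file of the `T > 0` composition layer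
of the row «box ⊂ union of certified cells ⇒ word» (hubbard-box-p2): `HubbardTTPrimeThermalPressureCellRule`
(joint tangent floor from one anchor in `(β, s, U)`; corner rule) and `HubbardTTPrimeThermalPressureBoxWords`
(density leg by CONCAVITY = two anchors at the slab ends; energy words; `meanEnergy_le_on_box_of_twoAnchors`).
hubbard-box-p1 g7's `HubbardTTPrimeThermalPressureDensityBand` (p540744) makes the density leg ONE-anchor too:
the interaction free entropy `p(β; n) − 2H_b(n/2)` is Lipschitz in `n` with the SHARP, volume-free constant
`β(4|t| + 4|t'| + U)` (`pressureTT'_sub_binEntropy_sub_ge_local / _le_local`). Composed (everything PROVED, no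
definition, no named fact, no number):

* §1 `pressureTT'_sub_binEntropy_ge_anchor`: from ONE density `n₀`, at the SAME `(β, t, t', U)`,
  `p(m) − 2H_b(m/2) ≥ p(n₀) − 2H_b(n₀/2) − β(4|t|+4|t'|+U)|m − n₀|` for every `m ∈ [0, 2)` (both sides of `n₀`);
  with a floor `W ≤ p(n₀)`: `le_pressureTT'_of_anchor_density_band`.
* §2 `meanEnergy_le_of_anchor_density_band`: the exact hot anchor `p(0; m) = 2H_b(m/2)` CANCELS the entropy
  shift, so a pressure floor `W ≤ p(β;t,t',U;n₀)` caps the thermal energy at every density: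
  `e_Φ(ω) ≤ (2H_b(n₀/2) − W)/β + (4|t|+4|t'|+U)·|m − n₀|` for every torus-limit sector Gibbs state at
  `(β, t, t', U, m)` — the density leg costs `(4|t|+4|t'|+U)·|Δn|` in ENERGY units, uniformly in `β`.
* §3 THE ONE-ANCHOR BOX WORD `meanEnergy_le_on_box_of_oneAnchor`: anchor `(β₀; t, s₀, U₀; n₀)` with a pressure
  floor `W₀` and torus-limit brackets `e_Φ ∈ [e⁻,e⁺]`, `K₂ ∈ [k⁻,k⁺]`, `D ∈ [d⁻,d⁺]` there ⇒ for every
  `β ≥ β₀ > 0`, `s ∈ [s₁,s₂]`, `U ∈ [U₁,U₂]` (`U₁ ≥ 0`), `m ∈ [n₁,n₂] ⊂ [0,2)` and every torus limit at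
  `(β, t, s, U, m)`:
  `e_Φ(ω) ≤ (2H_b(n₀/2) − T(β,s,U))/β + (4|t|+4|s|+U)·|m − n₀|`,
  `T = W₀ − [(β−β₀)e⁺ + max(β(s−s₀)k^∓) + max(β(U−U₀)d^∓)]` (`pressureTT'_jointTangent_floor_of_le` at density
  `n₀`, then §2 at the target coupling). ONE certified point ⇒ a certified `T > 0` word on a 4-D box.

Reading (cuprate box `(8 ± ½, −¼ ± 1/20, 0.875 ± 0.01)`, anchor at its centre, `T ≤ t/4`): the density leg costs
`(4 + 1.2 + 8.5)·0.01 ≈ 0.14 t` here versus `0.013–0.026 t` for the two-anchor chord of `…BoxWords` /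
`TypeClassSidecarReaderFillingBox` — use two anchors when two sidecars exist; this file is the fallback when only
one point is certified, and the density-direction EXTENSION of any thermal word beyond its slab.

WHAT THIS IS NOT: a certificate or a number of record; a phase / `T_c` statement; a grand-canonical statement.

## Mathlib / tree search

`lean search 'oneAnchor|anchor_density_band|binEntropy_ge_anchor'`: nothing. REUSED: `pressureTT'_sub_binEntropy_sub_ge_local`,
`pressureTT'_sub_binEntropy_sub_le_local` (`…DensityBand`), `pressureTT'_jointTangent_floor_of_le` (`…CellRule`),
`IsTorusLimitOfMixture.meanEnergy_hubbardTTPrime_le_binEntropy_sub_pressureTT'_div` (`…ThermalPressureLimit`).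

## References

* D. Ruelle, *Statistical Mechanics: Rigorous Results* (1969), §3.4. [cite: Ruelle1969, §3.4]
* R. B. Israel, *Convexity in the Theory of Lattice Gases* (1979), Lemma II.3.1, Thm. I.3.4. [cite: Israel1979, Lemma II.3.1]
* E. H. Lieb, Adv. Math. 11 (1973) 267, §V (5.2)–(5.4). [cite: Lieb1973, §V (5.2)–(5.4)]
-/

noncomputable section

namespace Literature.MathematicalPhysics.QuantumLattice

open Matrix Finset HubbardWave0 Literature.Probability.LatticeModels ThermodynamicLimit
open _root_.Filter
open scoped _root_.Topology ComplexOrder BigOperators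

namespace ThermodynamicLimit

/-! ### §1 The density band read from one anchor -/

section Band

variable {β : ℝ} (hβ : 0 ≤ β) (t t' : ℝ) {U : ℝ} (hU : 0 ≤ U)
include hβ hU

/-- **Interaction free entropy from ONE density anchor** (`β ≥ 0`, `U ≥ 0`, `n₀, m ∈ [0, 2)`):
`p(n₀) − 2H_b(n₀/2) − β(4|t|+4|t'|+U)·|m − n₀| ≤ p(m) − 2H_b(m/2)`. [cite: Ruelle1969, §3.4] -/
theorem pressureTT'_sub_binEntropy_ge_anchor {n₀ m : ℝ} (hn₀ : 0 ≤ n₀) (hn₀2 : n₀ < 2) (hm : 0 ≤ m)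
    (hm2 : m < 2) :
    (pressureTT' β t t' U n₀ - 2 * Real.binEntropy (n₀ / 2)) - β * (4 * |t| + 4 * |t'| + U) * |m - n₀| ≤
      pressureTT' β t t' U m - 2 * Real.binEntropy (m / 2) := by
  have hr : 0 ≤ β * (4 * |t| + 4 * |t'| + U) := by positivity
  rcases le_or_gt n₀ m with h | h
  · have hge := pressureTT'_sub_binEntropy_sub_ge_local hβ t t' hU hn₀ h hm2
    rw [abs_of_nonneg (sub_nonneg.2 h)]
    linarith
  · have hle := pressureTT'_sub_binEntropy_sub_le_local hβ t t' hU hm h.le hn₀2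
    rw [abs_of_neg (sub_neg.2 h)]
    have h4 : β * (4 * |t| + 4 * |t'|) * (n₀ - m) ≤ β * (4 * |t| + 4 * |t'| + U) * (n₀ - m) :=
      mul_le_mul_of_nonneg_right (mul_le_mul_of_nonneg_left (by linarith) hβ) (by linarith)
    nlinarith

/-- **Pressure floor from ONE density anchor**: `W ≤ p(β;t,t',U;n₀)` ⇒ for every `m ∈ [0,2)`,
`W + 2H_b(m/2) − 2H_b(n₀/2) − β(4|t|+4|t'|+U)|m − n₀| ≤ p(β;t,t',U;m)`. [cite: Ruelle1969, §3.4] -/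
theorem le_pressureTT'_of_anchor_density_band {n₀ m W : ℝ} (hn₀ : 0 ≤ n₀) (hn₀2 : n₀ < 2) (hm : 0 ≤ m)
    (hm2 : m < 2) (hW : W ≤ pressureTT' β t t' U n₀) :
    W + 2 * Real.binEntropy (m / 2) - 2 * Real.binEntropy (n₀ / 2) - β * (4 * |t| + 4 * |t'| + U) * |m - n₀| ≤
      pressureTT' β t t' U m := by
  have h := pressureTT'_sub_binEntropy_ge_anchor hβ t t' hU hn₀ hn₀2 hm hm2
  linarith

end Band

/-! ### §2 The thermal-energy cap at every density from one pressure floor -/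

section Energy

/-- **Energy cap at density `m` from a pressure floor at density `n₀`** (same `β > 0`, `t, t'`, `U ≥ 0`;
`n₀, m ∈ [0,2)`): `W ≤ p(β;t,t',U;n₀)` ⇒ for every torus-limit sector Gibbs state at `(β, t, t', U, m)`,
`e_Φ(ω) ≤ (2H_b(n₀/2) − W)/β + (4|t|+4|t'|+U)·|m − n₀|` (the exact hot anchor `p(0;m) = 2H_b(m/2)` cancels the
entropy shift of the band). [cite: Israel1979, Lemma II.3.1] [cite: Ruelle1969, §3.4] -/
theorem meanEnergy_le_of_anchor_density_band (t t' : ℝ) {U : ℝ} (hU : 0 ≤ U) {β : ℝ} (hβ : 0 < β)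
    {n₀ m W : ℝ} (hn₀ : 0 ≤ n₀) (hn₀2 : n₀ < 2) (hm : 0 ≤ m) (hm2 : m < 2) (hW : W ≤ pressureTT' β t t' U n₀) :
    ∀ (ω : InfVolFermionState 2) (Ls : ℕ → ℕ), Tendsto Ls atTop atTop →
      ω.IsTorusLimitOfMixture (sectorGibbsCount m) (fun L => sectorGibbsWeightTT' β t t' U m L)
        (fun L => sectorGibbsVectorTT' t t' U m L) Ls →
      ω.meanEnergy (hubbardTTPrimeFermionInteraction t t' U) 1 ≤
        (2 * Real.binEntropy (n₀ / 2) - W) / β + (4 * |t| + 4 * |t'| + U) * |m - n₀| := by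
  intro ω Ls hLs h
  have hfl := le_pressureTT'_of_anchor_density_band hβ.le t t' hU hn₀ hn₀2 hm hm2 hW
  have hcap := meanEnergy_le_of_pressureFloor hm hm2 t t' hU hβ hfl ω Ls hLs h
  refine hcap.trans (le_of_eq ?_)
  field_simp
  ring

end Energy

/-! ### §3 The one-anchor box word -/

section OneAnchor

/-- **THE `T > 0` BOX WORD FROM ONE ANCHOR.** Anchor `(β₀; t, s₀, U₀; n₀)` (`β₀ > 0`, `U₀ ≥ 0`, `0 ≤ n₀ < 2`)
with a certified pressure floor `W₀ ≤ p(β₀;t,s₀,U₀;n₀)` and, for every torus-limit sector Gibbs state there,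
`e_Φ ∈ [e⁻,e⁺]`, `K₂ ∈ [k⁻,k⁺]`, `D ∈ [d⁻,d⁺]`. Then for every `β ≥ β₀` (cell `T ≤ 1/β₀`), `s ∈ [s₁,s₂]`,
`U ∈ [U₁,U₂]` (`U₁ ≥ 0`), `m ∈ [n₁,n₂]` (`0 ≤ n₁`, `n₂ < 2`) and every torus limit at `(β, t, s, U, m)`:
`e_Φ(ω) ≤ (2H_b(n₀/2) − T)/β + (4|t|+4|s|+U)·|m − n₀|`,
`T = W₀ − [(β−β₀)e⁺ + max(β(s−s₀)k⁻, β(s−s₀)k⁺) + max(β(U−U₀)d⁻, β(U−U₀)d⁺)]`.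
[cite: Israel1979, Lemma II.3.1] [cite: Israel1979, Thm. I.3.4] [cite: Lieb1973, §V (5.2)–(5.4)] [cite: Ruelle1969, §3.4] -/
theorem meanEnergy_le_on_box_of_oneAnchor {n₀ : ℝ} (hn₀ : 0 ≤ n₀) (hn₀2 : n₀ < 2) {n₁ n₂ : ℝ} (hn₁ : 0 ≤ n₁)
    (hn₂ : n₂ < 2) {β₀ : ℝ} (hβ₀ : 0 < β₀) (t : ℝ) {s₀ U₀ : ℝ} (hU₀ : 0 ≤ U₀) {s₁ s₂ U₁ U₂ : ℝ}
    (hU₁ : 0 ≤ U₁) {W₀ elo ehi klo khi dlo dhi : ℝ} (hW₀ : W₀ ≤ pressureTT' β₀ t s₀ U₀ n₀)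
    (he : ∀ (ω : InfVolFermionState 2) (Ls : ℕ → ℕ), Tendsto Ls atTop atTop →
      ω.IsTorusLimitOfMixture (sectorGibbsCount n₀) (fun L => sectorGibbsWeightTT' β₀ t s₀ U₀ n₀ L)
        (fun L => sectorGibbsVectorTT' t s₀ U₀ n₀ L) Ls →
      elo ≤ ω.meanEnergy (hubbardTTPrimeFermionInteraction t s₀ U₀) 1 ∧
        ω.meanEnergy (hubbardTTPrimeFermionInteraction t s₀ U₀) 1 ≤ ehi)
    (hk : ∀ (ω : InfVolFermionState 2) (Ls : ℕ → ℕ), Tendsto Ls atTop atTop →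
      ω.IsTorusLimitOfMixture (sectorGibbsCount n₀) (fun L => sectorGibbsWeightTT' β₀ t s₀ U₀ n₀ L)
        (fun L => sectorGibbsVectorTT' t s₀ U₀ n₀ L) Ls →
      klo ≤ ω.meanEnergy (hubbardTTPrimeFermionInteraction 0 1 0) 1 ∧
        ω.meanEnergy (hubbardTTPrimeFermionInteraction 0 1 0) 1 ≤ khi)
    (hd : ∀ (ω : InfVolFermionState 2) (Ls : ℕ → ℕ), Tendsto Ls atTop atTop →
      ω.IsTorusLimitOfMixture (sectorGibbsCount n₀) (fun L => sectorGibbsWeightTT' β₀ t s₀ U₀ n₀ L)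
        (fun L => sectorGibbsVectorTT' t s₀ U₀ n₀ L) Ls →
      dlo ≤ ω.meanEnergy (hubbardTTPrimeFermionInteraction 0 0 1) 1 ∧
        ω.meanEnergy (hubbardTTPrimeFermionInteraction 0 0 1) 1 ≤ dhi) :
    ∀ β : ℝ, β₀ ≤ β → ∀ s ∈ Set.Icc s₁ s₂, ∀ U ∈ Set.Icc U₁ U₂, ∀ m ∈ Set.Icc n₁ n₂,
      ∀ (ω : InfVolFermionState 2) (Ls : ℕ → ℕ), Tendsto Ls atTop atTop →
      ω.IsTorusLimitOfMixture (sectorGibbsCount m) (fun L => sectorGibbsWeightTT' β t s U m L)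
        (fun L => sectorGibbsVectorTT' t s U m L) Ls →
      ω.meanEnergy (hubbardTTPrimeFermionInteraction t s U) 1 ≤
        (2 * Real.binEntropy (n₀ / 2) -
            (W₀ - ((β - β₀) * ehi + max (β * (s - s₀) * klo) (β * (s - s₀) * khi) +
              max (β * (U - U₀) * dlo) (β * (U - U₀) * dhi)))) / β +
          (4 * |t| + 4 * |s| + U) * |m - n₀| := by
  intro β hβ s _ U hU m hm ω Ls hLs h
  have hβpos : 0 < β := hβ₀.trans_le hβ
  have hU0 : 0 ≤ U := hU₁.trans hU.1
  have hT := pressureTT'_jointTangent_floor_of_le hn₀ hn₀2 hβ₀.le hβ t (s := s) hU₀ hU0 he hk hd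
  have hT' : W₀ - ((β - β₀) * ehi + max (β * (s - s₀) * klo) (β * (s - s₀) * khi) +
      max (β * (U - U₀) * dlo) (β * (U - U₀) * dhi)) ≤ pressureTT' β t s U n₀ := by linarith
  exact meanEnergy_le_of_anchor_density_band t s hU0 hβpos hn₀ hn₀2 (hn₁.trans hm.1) (hm.2.trans_lt hn₂) hT' ω
    Ls hLs h

end OneAnchor

end ThermodynamicLimit

end Literature.MathematicalPhysics.QuantumLattice

end
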